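import Mathlib
import Literature.Computability.Complexity.FourierTails
import Literature.Probability.RandomGraphs.LowDegree
import Summits.QuantumAdvantage.QuantumAdvantage.Theorems.MobiusLadderLiouvilleOrthogonalTC0StubSliceL2
import Summits.QuantumAdvantage.QuantumAdvantage.Theorems.MobiusLadderLiouvilleOrthogonalTC0StubSliceTail
import Summits.QuantumAdvantage.QuantumAdvantage.Theorems.MobiusLadderLiouvilleOrthogonalTC0StubSliceCriterion
import Summits.QuantumAdvantage.QuantumAdvantage.Theorems.MobiusLadderLiouvilleOrthogonalTC0StubSymmetricRung
import HarnessLib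

/-!
# Crux `MobiusLadder.LiouvilleOrthogonalTC0` (stmt-QuantumAdvantage-1393), line `Sketch`, skeleton v8.2:
stub `stub_symmetricRung_moebius` — the μ-twin of the symmetric-digital rung

The Möbius analogue of `stub_symmetricRung`: `μ` is asymptotically orthogonal to EVERY Boolean
function of the Hamming weight `s₂(N)` of the `n` low binary digits, assembled from two inputs on the
Gelfond sums `S_n(α) = Σ_{N<2ⁿ} μ(N) e(α s₂(N))`:
* `hSmall` — small frequencies `|α| ≤ n^{a−1/2}`;
* `hLarge` — large frequencies `n^{a−1/2} ≤ |α| ≤ 1/2`.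
The third input of the λ-rung, the slice criterion, is derived here for `μ`
(`symmRungMu_sliceCriterion`) as a one-line instantiation of the abstract criterion
`sliceCrit_eventually` with the Parseval identity `sliceL2_general` (at `g = μ`) and the Hoeffding
tail `stub_sliceTail`; `μ` only enters through `|μ(N)| ≤ 1`.
The assembly is bookkeeping: at the frequency `k/(n+1)` (`k ≤ n`) use `hSmall`/`hLarge` with `B = 1`,
at `k/(n+1)` itself when it is `≤ 1/2` and at `k/(n+1) − 1 ∈ (−1/2, 0)` otherwise (`S_n` is
`1`-periodic in `α` because `s₂(N)` is an integer, `symmRung_phase_sub_one`), then feed the uniform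
bound `2ⁿ/n` to the criterion with `G' = sgn ∘ G`.
-/

set_option linter.dupNamespace false -- D-0017: single-problem summit ⇒ `QuantumAdvantage.QuantumAdvantage` by design

noncomputable section

namespace Summit.QuantumAdvantage.QuantumAdvantage.Theorems.LiouvilleOrthogonalTC0

open Filter Finset
open Literature.Probability.RandomGraphs.LowDegree (sgn)

/-- **Slice criterion for the Möbius function.** Write `s₂(N)` for the number of `1`-digits among
the `n` low binary digits of `N` and `S(θ) := ∑_{N < 2ⁿ} μ(N) e(θ s₂(N))` for the Gelfond sums of
`μ`. For every `ε > 0`, for all large `n`: if all the `n + 1` values `|S(k/(n+1))|` (`k ≤ n`) are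
`≤ 2ⁿ/n`, then `|∑_{N < 2ⁿ} μ(N) G(s₂(N))| ≤ ε 2ⁿ` for every `G : ℕ → ℝ` with `|G| ≤ 1`.
(The abstract criterion `sliceCrit_eventually`, fed with the discrete Parseval identity
`sliceL2_general` at `g = μ` and the Hoeffding tail `stub_sliceTail`.) -/
theorem symmRungMu_sliceCriterion :
    ∀ ε : ℝ, 0 < ε → ∀ᶠ n : ℕ in atTop,
      (∀ k ∈ Finset.range (n + 1),
        ‖∑ N ∈ Finset.range (2 ^ n), ((ArithmeticFunction.moebius N : ℤ) : ℂ) *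
            Complex.exp (((2 * Real.pi * ((k : ℝ) / (n + 1)) *
              ((Finset.univ.filter fun i : Fin n => Nat.testBit N i = true).card : ℝ) : ℝ) : ℂ) *
                Complex.I)‖ ≤ (2 : ℝ) ^ n / n) →
      ∀ G : ℕ → ℝ, (∀ j, |G j| ≤ 1) →
        |∑ N ∈ Finset.range (2 ^ n), ((ArithmeticFunction.moebius N : ℤ) : ℝ) *
            G (Finset.univ.filter fun i : Fin n => Nat.testBit N i = true).card| ≤ ε * (2 : ℝ) ^ n := by
  have hw : ∀ n, ∀ N ∈ Finset.range (2 ^ n),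
      (Finset.univ.filter fun i : Fin n => Nat.testBit N i = true).card < n + 1 :=
    fun n N _ => Nat.lt_succ_of_le ((Finset.card_filter_le _ _).trans (by simp))
  exact sliceCrit_eventually (fun n => Finset.range (2 ^ n))
    (fun n N => (Finset.univ.filter fun i : Fin n => Nat.testBit N i = true).card)
    (fun N => ((ArithmeticFunction.moebius N : ℤ) : ℝ))
    (fun N => by exact_mod_cast ArithmeticFunction.abs_moebius_le_one) hw
    (fun n k => ‖∑ N ∈ Finset.range (2 ^ n), ((ArithmeticFunction.moebius N : ℤ) : ℂ) *
      Complex.exp (((2 * Real.pi * ((k : ℝ) / (n + 1)) *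
        ((Finset.univ.filter fun i : Fin n => Nat.testBit N i = true).card : ℝ) : ℝ) : ℂ) *
          Complex.I)‖)
    (fun _ _ => norm_nonneg _)
    (fun n => (sliceL2_general n (Finset.range (2 ^ n)) (fun N => ArithmeticFunction.moebius N)
      (fun N => (Finset.univ.filter fun i : Fin n => Nat.testBit N i = true).card) (hw n)).le)
    stub_sliceTail

/-- **Stub `stub_symmetricRung_moebius` (line `Sketch`, v8.2, μ-twin of `stub_symmetricRung`).**
From the small-frequency bound `hSmall` and the large-frequency bound `hLarge` on the Gelfond sums
`S_n(α) = Σ_{N<2ⁿ} μ(N) e(α s₂(N))` of the Möbius function (with `s₂(N)` the number of `1`-digits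
among the `n` low binary digits of `N`): for every `ε > 0`, eventually in `n`,
`|Σ_{N<2ⁿ} μ(N)·sgn G(s₂(N))| ≤ ε·2ⁿ` for ALL `G : ℕ → Bool`. The slice criterion is built in
(`symmRungMu_sliceCriterion`); the `n + 1` frequencies `k/(n+1)` are reached from `hSmall`/`hLarge`
with `B = 1`, directly when `k/(n+1) ≤ 1/2` and through `k/(n+1) − 1 ∈ (−1/2, 0)` and the
`1`-periodicity of `S_n` otherwise. -/
theorem stub_symmetricRung_moebius (hSmall : ∃ a : ℝ, 0 < a ∧ ∀ B : ℕ, ∀ᶠ n : ℕ in atTop, ∀ α : ℝ, |α| ≤ (n : ℝ) ^ (a - 1 / 2) → ‖∑ N ∈ Finset.range (2 ^ n), ((ArithmeticFunction.moebius N : ℤ) : ℂ) * Complex.exp (((2 * Real.pi * α * ((Finset.univ.filter fun i : Fin n => Nat.testBit N i = true).card : ℝ) : ℝ) : ℂ) * Complex.I)‖ ≤ (2 : ℝ) ^ n / (n : ℝ) ^ B) (hLarge : ∀ a : ℝ, 0 < a → ∀ B : ℕ, ∀ᶠ n : ℕ in atTop, ∀ α : ℝ, (n : ℝ) ^ (a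 - 1 / 2) ≤ |α| → |α| ≤ 1 / 2 → ‖∑ N ∈ Finset.range (2 ^ n), ((ArithmeticFunction.moebius N : ℤ) : ℂ) * Complex.exp (((2 * Real.pi * α * ((Finset.univ.filter fun i : Fin n => Nat.testBit N i = true).card : ℝ) : ℝ) : ℂ) * Complex.I)‖ ≤ (2 : ℝ) ^ n / (n : ℝ) ^ B) : ∀ ε : ℝ, 0 < ε → ∀ᶠ n : ℕ in atTop, ∀ G : ℕ → Bool, |∑ N ∈ Finset.range (2 ^ n), ((ArithmeticFunction.moebius N : ℤ) : ℝ) * sgn (G (Finset.univ.filter fun i : Fin n => Nat.testBit N i = true).card)| ≤ ε * (2 : ℝ) ^ n := by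
  intro ε hε
  obtain ⟨a, ha, hS⟩ := hSmall
  filter_upwards [hS 1, hLarge a ha 1, symmRungMu_sliceCriterion ε hε] with n hSn hLn hCn G
  -- the uniform bound at the `n + 1` frequencies `k/(n+1)`
  have key : ∀ k ∈ Finset.range (n + 1),
      ‖∑ N ∈ Finset.range (2 ^ n), ((ArithmeticFunction.moebius N : ℤ) : ℂ) *
          Complex.exp (((2 * Real.pi * ((k : ℝ) / (n + 1)) *
            ((Finset.univ.filter fun i : Fin n => Nat.testBit N i = true).card : ℝ) : ℝ) : ℂ) * Complex.I)‖
        ≤ (2 : ℝ) ^ n / n := by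
    intro k hk
    have hk' : (k : ℝ) < n + 1 := by
      have := Finset.mem_range.1 hk; exact_mod_cast this
    have hn1 : (0 : ℝ) < n + 1 := by positivity
    have hθ0 : 0 ≤ (k : ℝ) / (n + 1) := by positivity
    have hθ1 : (k : ℝ) / (n + 1) < 1 := by rw [div_lt_one hn1]; exact hk'
    by_cases hθ : (k : ℝ) / (n + 1) ≤ 1 / 2
    · by_cases hsm : |(k : ℝ) / (n + 1)| ≤ (n : ℝ) ^ (a - 1 / 2)
      · simpa only [pow_one] using hSn _ hsm
      · have h2 : |(k : ℝ) / (n + 1)| ≤ 1 / 2 := by rwa [abs_of_nonneg hθ0]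
        simpa only [pow_one] using hLn _ (le_of_lt (not_le.mp hsm)) h2
    · -- pass to the frequency `k/(n+1) - 1 ∈ (-1/2, 0)`
      have hper : ∀ N ∈ Finset.range (2 ^ n), ((ArithmeticFunction.moebius N : ℤ) : ℂ) *
          Complex.exp (((2 * Real.pi * ((k : ℝ) / (n + 1) - 1) *
            ((Finset.univ.filter fun i : Fin n => Nat.testBit N i = true).card : ℝ) : ℝ) : ℂ) * Complex.I) =
          ((ArithmeticFunction.moebius N : ℤ) : ℂ) *
          Complex.exp (((2 * Real.pi * ((k : ℝ) / (n + 1)) *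
            ((Finset.univ.filter fun i : Fin n => Nat.testBit N i = true).card : ℝ) : ℝ) : ℂ) * Complex.I) := by
        intro N _
        rw [symmRung_phase_sub_one]
      rw [← Finset.sum_congr rfl hper]
      have hθ' : |(k : ℝ) / (n + 1) - 1| ≤ 1 / 2 := by
        rw [abs_le]; constructor <;> linarith [not_le.mp hθ]
      by_cases hsm : |(k : ℝ) / (n + 1) - 1| ≤ (n : ℝ) ^ (a - 1 / 2)
      · simpa only [pow_one] using hSn _ hsm
      · simpa only [pow_one] using hLn _ (le_of_lt (not_le.mp hsm)) hθ'
  exact hCn key (fun j => sgn (G j)) (fun j => by cases G j <;> simp [sgn])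

end Summit.QuantumAdvantage.QuantumAdvantage.Theorems.LiouvilleOrthogonalTC0
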